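import Summits.CriticalPhenomena.CardyFormulaZ2.Theorems.CardyTensorRGPolyominoGaussianLawStubDilationEquicontinuityPart2

/-!
# The bond-`ℤ²` crossing probability of the unit square tends to `1/2` — frames
# (crux `PolyominoGaussianLaw`, stmt-CriticalPhenomena-14337, route `CardyTensorRG`, line `registered`)

Bookkeeping for the square-limit theorem (Parts 1–3): the coordinate swap `z ↦ (im z, re z)` and the
axis-parallel affine maps `z ↦ (a re z + b) + i (c im z + d)` as self-homeomorphisms of `ℂ`
(`sq_exists_swap`, `sq_exists_affine`), and the images of the closed/open model square `[-1,1]²`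
and of its bottom/top sides under the frame "affine, then swap" (`sq_image_frame_*`): the closed/open
box `[d-c, d+c] × [b-a, b+a]` and its LEFT/RIGHT sides. Consequently the Schramm–Smirnov quad
`squareModelQuad (A.trans S)` of such a frame has that box as carrier and the left/right sides as
`∂₀`, `∂₂` (`sq_squareModelQuad_frame`) — this turns the tree's bottom-to-top square models
(`dl_carrier_squareModelQuad`, `dl_side_zero/two_squareModelQuad`) into left-to-right ones.
-/

noncomputable section

open Set Metric Complex
open scoped unitInterval
open Literature.Probability.LatticeModels Literature.Probability.Percolation
open Literature.Probability.Percolation.QuadCrossing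

namespace Summit.CriticalPhenomena.CardyFormulaZ2.Cruxes.PolyominoGaussianLaw.Birth

/-! ### Frames: the coordinate swap and axis-parallel affine maps -/

/-- The coordinate swap `z ↦ (im z) + i (re z)` as a self-homeomorphism of `ℂ`. [folklore] -/
theorem sq_exists_swap : ∃ S : ℂ ≃ₜ ℂ, ∀ z, S z = ⟨z.im, z.re⟩ := by
  have hc : Continuous fun z : ℂ => (⟨z.im, z.re⟩ : ℂ) := by
    refine Continuous.comp (f := fun z : ℂ => (z.im, z.re))
      (g := fun p : ℝ × ℝ => (⟨p.1, p.2⟩ : ℂ)) ?_ (by fun_prop)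
    exact Complex.equivRealProdCLM.symm.continuous
  exact ⟨{ toFun := fun z => ⟨z.im, z.re⟩
           invFun := fun z => ⟨z.im, z.re⟩
           left_inv := fun z => rfl
           right_inv := fun z => rfl
           continuous_toFun := hc
           continuous_invFun := hc }, fun z => rfl⟩

/-- Axis-parallel affine self-homeomorphisms of `ℂ`: `z ↦ (a re z + b) + i (c im z + d)`,
`a, c > 0`. [folklore] -/
theorem sq_exists_affine (a b c d : ℝ) (ha : 0 < a) (hc : 0 < c) :
    ∃ A : ℂ ≃ₜ ℂ, ∀ z, A z = ⟨a * z.re + b, c * z.im + d⟩ := by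
  have hcont : ∀ a b c d : ℝ, Continuous fun z : ℂ => (⟨a * z.re + b, c * z.im + d⟩ : ℂ) := by
    intro a b c d
    refine Continuous.comp (f := fun z : ℂ => (a * z.re + b, c * z.im + d))
      (g := fun p : ℝ × ℝ => (⟨p.1, p.2⟩ : ℂ)) ?_ (by fun_prop)
    exact Complex.equivRealProdCLM.symm.continuous
  refine ⟨{ toFun := fun z => ⟨a * z.re + b, c * z.im + d⟩
            invFun := fun z => ⟨a⁻¹ * (z.re - b), c⁻¹ * (z.im - d)⟩
            left_inv := fun z => ?_
            right_inv := fun z => ?_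
            continuous_toFun := hcont a b c d
            continuous_invFun := ?_ }, fun z => rfl⟩
  · apply Complex.ext
    · show a⁻¹ * (a * z.re + b - b) = z.re
      field_simp; ring
    · show c⁻¹ * (c * z.im + d - d) = z.im
      field_simp; ring
  · apply Complex.ext
    · show a * (a⁻¹ * (z.re - b)) + b = z.re
      field_simp; ring
    · show c * (c⁻¹ * (z.im - d)) + d = z.im
      field_simp; ring
  · have h := hcont a⁻¹ (-(a⁻¹ * b)) c⁻¹ (-(c⁻¹ * d))
    refine h.congr fun z => ?_
    apply Complex.ext <;> simp <;> ring

section Frame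

variable {A S : ℂ ≃ₜ ℂ} {a b c d : ℝ}

/-- The "affine, then swap" frame in coordinates. [folklore] -/
theorem sq_frame_apply (hA : ∀ z, A z = ⟨a * z.re + b, c * z.im + d⟩) (hS : ∀ z, S z = ⟨z.im, z.re⟩)
    (z : ℂ) : (A.trans S) z = ⟨c * z.im + d, a * z.re + b⟩ := by
  rw [Homeomorph.trans_apply, hA, hS]

/-- Image of the closed model square under the frame: the closed box
`[d - c, d + c] × [b - a, b + a]`. [folklore] -/
theorem sq_image_frame_Icc (hA : ∀ z, A z = ⟨a * z.re + b, c * z.im + d⟩) (hS : ∀ z, S z = ⟨z.im, z.re⟩)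
    (ha : 0 < a) (hc : 0 < c) :
    (A.trans S) '' (Icc (-1 : ℝ) 1 ×ℂ Icc (-1 : ℝ) 1) = Icc (d - c) (d + c) ×ℂ Icc (b - a) (b + a) := by
  ext w
  simp only [mem_image, mem_reProdIm, mem_Icc]
  constructor
  · rintro ⟨z, ⟨⟨h1, h2⟩, h3, h4⟩, rfl⟩
    rw [sq_frame_apply hA hS]
    refine ⟨⟨?_, ?_⟩, ?_, ?_⟩ <;> dsimp only <;> nlinarith
  · rintro ⟨⟨h1, h2⟩, h3, h4⟩
    refine ⟨⟨(w.im - b) / a, (w.re - d) / c⟩, ⟨⟨?_, ?_⟩, ?_, ?_⟩, ?_⟩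
    · rw [le_div_iff₀ ha]; linarith
    · rw [div_le_iff₀ ha]; linarith
    · rw [le_div_iff₀ hc]; linarith
    · rw [div_le_iff₀ hc]; linarith
    · rw [sq_frame_apply hA hS]
      apply Complex.ext <;> dsimp only <;> field_simp <;> ring

/-- Image of the open model square under the frame: the open box. [folklore] -/
theorem sq_image_frame_Ioo (hA : ∀ z, A z = ⟨a * z.re + b, c * z.im + d⟩) (hS : ∀ z, S z = ⟨z.im, z.re⟩)
    (ha : 0 < a) (hc : 0 < c) :
    (A.trans S) '' (Ioo (-1 : ℝ) 1 ×ℂ Ioo (-1 : ℝ) 1) = Ioo (d - c) (d + c) ×ℂ Ioo (b - a) (b + a) := by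
  ext w
  simp only [mem_image, mem_reProdIm, mem_Ioo]
  constructor
  · rintro ⟨z, ⟨⟨h1, h2⟩, h3, h4⟩, rfl⟩
    rw [sq_frame_apply hA hS]
    refine ⟨⟨?_, ?_⟩, ?_, ?_⟩ <;> dsimp only <;> nlinarith
  · rintro ⟨⟨h1, h2⟩, h3, h4⟩
    refine ⟨⟨(w.im - b) / a, (w.re - d) / c⟩, ⟨⟨?_, ?_⟩, ?_, ?_⟩, ?_⟩
    · rw [lt_div_iff₀ ha]; linarith
    · rw [div_lt_iff₀ ha]; linarith
    · rw [lt_div_iff₀ hc]; linarith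
    · rw [div_lt_iff₀ hc]; linarith
    · rw [sq_frame_apply hA hS]
      apply Complex.ext <;> dsimp only <;> field_simp <;> ring

/-- Image of the bottom side of the model square under the frame: the LEFT side of the box. [folklore] -/
theorem sq_image_frame_bottom (hA : ∀ z, A z = ⟨a * z.re + b, c * z.im + d⟩)
    (hS : ∀ z, S z = ⟨z.im, z.re⟩) (ha : 0 < a) :
    (A.trans S) '' {p : ℂ | p.im = -1 ∧ p.re ∈ Icc (-1 : ℝ) 1} =
      {w : ℂ | w.re = d - c ∧ w.im ∈ Icc (b - a) (b + a)} := by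
  ext w
  simp only [mem_image, mem_setOf_eq, mem_Icc]
  constructor
  · rintro ⟨z, ⟨h1, h2, h3⟩, rfl⟩
    rw [sq_frame_apply hA hS]
    refine ⟨?_, ?_, ?_⟩ <;> dsimp only
    · rw [h1]; ring
    · nlinarith
    · nlinarith
  · rintro ⟨h1, h2, h3⟩
    refine ⟨⟨(w.im - b) / a, -1⟩, ⟨rfl, ?_, ?_⟩, ?_⟩
    · show -1 ≤ (w.im - b) / a
      rw [le_div_iff₀ ha]; linarith
    · show (w.im - b) / a ≤ 1
      rw [div_le_iff₀ ha]; linarith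
    · rw [sq_frame_apply hA hS]
      apply Complex.ext <;> dsimp only
      · rw [h1]; ring
      · field_simp; ring

/-- Image of the top side of the model square under the frame: the RIGHT side of the box. [folklore] -/
theorem sq_image_frame_top (hA : ∀ z, A z = ⟨a * z.re + b, c * z.im + d⟩)
    (hS : ∀ z, S z = ⟨z.im, z.re⟩) (ha : 0 < a) :
    (A.trans S) '' {p : ℂ | p.im = 1 ∧ p.re ∈ Icc (-1 : ℝ) 1} =
      {w : ℂ | w.re = d + c ∧ w.im ∈ Icc (b - a) (b + a)} := by
  ext w
  simp only [mem_image, mem_setOf_eq, mem_Icc]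
  constructor
  · rintro ⟨z, ⟨h1, h2, h3⟩, rfl⟩
    rw [sq_frame_apply hA hS]
    refine ⟨?_, ?_, ?_⟩ <;> dsimp only
    · rw [h1]; ring
    · nlinarith
    · nlinarith
  · rintro ⟨h1, h2, h3⟩
    refine ⟨⟨(w.im - b) / a, 1⟩, ⟨rfl, ?_, ?_⟩, ?_⟩
    · show -1 ≤ (w.im - b) / a
      rw [le_div_iff₀ ha]; linarith
    · show (w.im - b) / a ≤ 1
      rw [div_le_iff₀ ha]; linarith
    · rw [sq_frame_apply hA hS]
      apply Complex.ext <;> dsimp only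
      · rw [h1]; ring
      · field_simp; ring

/-- The quad of the frame: carrier = the closed box, `∂₀` = left side, `∂₂` = right side. [folklore] -/
theorem sq_squareModelQuad_frame : ∀ {A S : ℂ ≃ₜ ℂ} {a b c d : ℝ},
    (∀ z, A z = ⟨a * z.re + b, c * z.im + d⟩) → (∀ z, S z = ⟨z.im, z.re⟩) → 0 < a → 0 < c →
    (Literature.Probability.Percolation.squareModelQuad (A.trans S)).carrier =
        (Set.Icc (d - c) (d + c) ×ℂ Set.Icc (b - a) (b + a)) ∧
      (Literature.Probability.Percolation.squareModelQuad (A.trans S)).side 0 =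
        {w : ℂ | w.re = d - c ∧ w.im ∈ Set.Icc (b - a) (b + a)} ∧
      (Literature.Probability.Percolation.squareModelQuad (A.trans S)).side 2 =
        {w : ℂ | w.re = d + c ∧ w.im ∈ Set.Icc (b - a) (b + a)} := by
  intro A S a b c d hA hS ha hc
  refine ⟨?_, ?_, ?_⟩
  · rw [dl_carrier_squareModelQuad, sq_image_frame_Icc hA hS ha hc]
  · rw [dl_side_zero_squareModelQuad, sq_image_frame_bottom hA hS ha]
  · rw [dl_side_two_squareModelQuad, sq_image_frame_top hA hS ha]

end Frame


end Summit.CriticalPhenomena.CardyFormulaZ2.Cruxes.PolyominoGaussianLaw.Birth
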